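import Summits.Ventures.PercRepro.S1CFGFourAll
import Summits.Ventures.PercRepro.S1CFGLineTwo

/-!
# PercRepro — THE ν = 4 CAPS AT `n = 11 … 16` POINTS, BY NUMBER (p1, gen 38)

The numerals of the general caps of S1CFGThree / S1CFGFourAll / S1CFGLineTwo for a loopless coloop-free matroid of
nullity `4` on `n` points, in the rank forms `{X : Set α | X ⊆ M.E ∧ X.ncard = k ∧ M.eRk X ≤ s}.ncard` that p7's
pricing LPs consume (`(2,1)`: `D₂ ≤ 6`, `(3,1)`: `Q₃¹ ≤ 4`, `(4,1)`: `Q₄¹ ≤ 1` are `n`-free, S1CFGSmall):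

| `n` | `D₃ = Q₃²` (`6n − 20`) | `Q₄²` (`max (n + 29) (4n − 15)`) | `D₄ = Q₄³` (`6·C(n−4,2) + 4(n−4) + 1`; `178` at `n = 11`) |
|---|---|---|---|
| 11 | 46 | 40 | 178 |
| 12 | 52 | 41 | 201 |
| 13 | 58 | 42 | 253 |
| 14 | 64 | 43 | 311 |
| 15 | 70 | 45 | 375 |
| 16 | 76 | 49 | 445 |

Every theorem is the general statement instantiated and evaluated; nothing about any cell is claimed. Axioms: standard.
-/

open scoped Matroid

namespace PercRepro

namespace S1CFG

open Set S1CF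

variable {α : Type}

/-- `D₃ ≤ 46` on `11` points (rank form). -/
theorem ncard_three_eRk_le_two_le_eleven (M : Matroid α) [M.Finite] (hL : ∀ e ∈ M.E, ¬ M.IsLoop e)
    (hK : ∀ e, ¬ M.IsColoop e) (hd : M.E.encard = M.eRank + ((4 : ℕ) : ℕ∞)) (hn : M.E.ncard = 11) :
    {X : Set α | X ⊆ M.E ∧ X.ncard = 3 ∧ M.eRk X ≤ 2}.ncard ≤ 46 := by
  have := ncard_three_eRk_le_two_le M hL hK hd (by omega)
  rw [hn] at this
  exact this

/-- `Q₄² ≤ 40` on `11` points. -/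
theorem ncard_four_eRk_le_two_le_eleven (M : Matroid α) [M.Finite] (hL : ∀ e ∈ M.E, ¬ M.IsLoop e)
    (hK : ∀ e, ¬ M.IsColoop e) (hd : M.E.encard = M.eRank + ((4 : ℕ) : ℕ∞)) (hn : M.E.ncard = 11) :
    {X : Set α | X ⊆ M.E ∧ X.ncard = 4 ∧ M.eRk X ≤ 2}.ncard ≤ 40 := by
  have := ncard_four_eRk_le_two_le M hL hK hd (by omega)
  rw [hn] at this
  exact this

/-- `D₄ ≤ 178` on `11` points (rank form). -/
theorem ncard_four_eRk_le_three_le_eleven (M : Matroid α) [M.Finite] (hL : ∀ e ∈ M.E, ¬ M.IsLoop e)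
    (hK : ∀ e, ¬ M.IsColoop e) (hd : M.E.encard = M.eRank + ((4 : ℕ) : ℕ∞)) (hn : M.E.ncard = 11) :
    {X : Set α | X ⊆ M.E ∧ X.ncard = 4 ∧ M.eRk X ≤ 3}.ncard ≤ 178 :=
  ncard_four_eRk_le_three_le_of_eq_eleven M hL hK hd hn

/-- `D₃ ≤ 52` on `12` points (rank form). -/
theorem ncard_three_eRk_le_two_le_twelve (M : Matroid α) [M.Finite] (hL : ∀ e ∈ M.E, ¬ M.IsLoop e)
    (hK : ∀ e, ¬ M.IsColoop e) (hd : M.E.encard = M.eRank + ((4 : ℕ) : ℕ∞)) (hn : M.E.ncard = 12) :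
    {X : Set α | X ⊆ M.E ∧ X.ncard = 3 ∧ M.eRk X ≤ 2}.ncard ≤ 52 := by
  have := ncard_three_eRk_le_two_le M hL hK hd (by omega)
  rw [hn] at this
  exact this

/-- `Q₄² ≤ 41` on `12` points. -/
theorem ncard_four_eRk_le_two_le_twelve (M : Matroid α) [M.Finite] (hL : ∀ e ∈ M.E, ¬ M.IsLoop e)
    (hK : ∀ e, ¬ M.IsColoop e) (hd : M.E.encard = M.eRank + ((4 : ℕ) : ℕ∞)) (hn : M.E.ncard = 12) :
    {X : Set α | X ⊆ M.E ∧ X.ncard = 4 ∧ M.eRk X ≤ 2}.ncard ≤ 41 := by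
  have := ncard_four_eRk_le_two_le M hL hK hd (by omega)
  rw [hn] at this
  exact this

/-- `D₄ ≤ 201` on `12` points (rank form). -/
theorem ncard_four_eRk_le_three_le_twelve (M : Matroid α) [M.Finite] (hL : ∀ e ∈ M.E, ¬ M.IsLoop e)
    (hK : ∀ e, ¬ M.IsColoop e) (hd : M.E.encard = M.eRank + ((4 : ℕ) : ℕ∞)) (hn : M.E.ncard = 12) :
    {X : Set α | X ⊆ M.E ∧ X.ncard = 4 ∧ M.eRk X ≤ 3}.ncard ≤ 201 := by
  have := ncard_four_eRk_le_three_le M hL hK hd (by omega)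
  rw [hn] at this
  have hc : (12 - 4 : ℕ).choose 2 = 28 := by decide
  rw [hc] at this
  exact this

/-- `D₃ ≤ 58` on `13` points (rank form). -/
theorem ncard_three_eRk_le_two_le_thirteen (M : Matroid α) [M.Finite] (hL : ∀ e ∈ M.E, ¬ M.IsLoop e)
    (hK : ∀ e, ¬ M.IsColoop e) (hd : M.E.encard = M.eRank + ((4 : ℕ) : ℕ∞)) (hn : M.E.ncard = 13) :
    {X : Set α | X ⊆ M.E ∧ X.ncard = 3 ∧ M.eRk X ≤ 2}.ncard ≤ 58 := by
  have := ncard_three_eRk_le_two_le M hL hK hd (by omega)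
  rw [hn] at this
  exact this

/-- `Q₄² ≤ 42` on `13` points. -/
theorem ncard_four_eRk_le_two_le_thirteen (M : Matroid α) [M.Finite] (hL : ∀ e ∈ M.E, ¬ M.IsLoop e)
    (hK : ∀ e, ¬ M.IsColoop e) (hd : M.E.encard = M.eRank + ((4 : ℕ) : ℕ∞)) (hn : M.E.ncard = 13) :
    {X : Set α | X ⊆ M.E ∧ X.ncard = 4 ∧ M.eRk X ≤ 2}.ncard ≤ 42 := by
  have := ncard_four_eRk_le_two_le M hL hK hd (by omega)
  rw [hn] at this
  exact this

/-- `D₄ ≤ 253` on `13` points (rank form). -/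
theorem ncard_four_eRk_le_three_le_thirteen (M : Matroid α) [M.Finite] (hL : ∀ e ∈ M.E, ¬ M.IsLoop e)
    (hK : ∀ e, ¬ M.IsColoop e) (hd : M.E.encard = M.eRank + ((4 : ℕ) : ℕ∞)) (hn : M.E.ncard = 13) :
    {X : Set α | X ⊆ M.E ∧ X.ncard = 4 ∧ M.eRk X ≤ 3}.ncard ≤ 253 := by
  have := ncard_four_eRk_le_three_le M hL hK hd (by omega)
  rw [hn] at this
  have hc : (13 - 4 : ℕ).choose 2 = 36 := by decide
  rw [hc] at this
  exact this

/-- `D₃ ≤ 64` on `14` points (rank form). -/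
theorem ncard_three_eRk_le_two_le_fourteen (M : Matroid α) [M.Finite] (hL : ∀ e ∈ M.E, ¬ M.IsLoop e)
    (hK : ∀ e, ¬ M.IsColoop e) (hd : M.E.encard = M.eRank + ((4 : ℕ) : ℕ∞)) (hn : M.E.ncard = 14) :
    {X : Set α | X ⊆ M.E ∧ X.ncard = 3 ∧ M.eRk X ≤ 2}.ncard ≤ 64 := by
  have := ncard_three_eRk_le_two_le M hL hK hd (by omega)
  rw [hn] at this
  exact this

/-- `Q₄² ≤ 43` on `14` points. -/
theorem ncard_four_eRk_le_two_le_fourteen (M : Matroid α) [M.Finite] (hL : ∀ e ∈ M.E, ¬ M.IsLoop e)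
    (hK : ∀ e, ¬ M.IsColoop e) (hd : M.E.encard = M.eRank + ((4 : ℕ) : ℕ∞)) (hn : M.E.ncard = 14) :
    {X : Set α | X ⊆ M.E ∧ X.ncard = 4 ∧ M.eRk X ≤ 2}.ncard ≤ 43 := by
  have := ncard_four_eRk_le_two_le M hL hK hd (by omega)
  rw [hn] at this
  exact this

/-- `D₄ ≤ 311` on `14` points (rank form). -/
theorem ncard_four_eRk_le_three_le_fourteen (M : Matroid α) [M.Finite] (hL : ∀ e ∈ M.E, ¬ M.IsLoop e)
    (hK : ∀ e, ¬ M.IsColoop e) (hd : M.E.encard = M.eRank + ((4 : ℕ) : ℕ∞)) (hn : M.E.ncard = 14) :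
    {X : Set α | X ⊆ M.E ∧ X.ncard = 4 ∧ M.eRk X ≤ 3}.ncard ≤ 311 := by
  have := ncard_four_eRk_le_three_le M hL hK hd (by omega)
  rw [hn] at this
  have hc : (14 - 4 : ℕ).choose 2 = 45 := by decide
  rw [hc] at this
  exact this

/-- `D₃ ≤ 70` on `15` points (rank form). -/
theorem ncard_three_eRk_le_two_le_fifteen (M : Matroid α) [M.Finite] (hL : ∀ e ∈ M.E, ¬ M.IsLoop e)
    (hK : ∀ e, ¬ M.IsColoop e) (hd : M.E.encard = M.eRank + ((4 : ℕ) : ℕ∞)) (hn : M.E.ncard = 15) :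
    {X : Set α | X ⊆ M.E ∧ X.ncard = 3 ∧ M.eRk X ≤ 2}.ncard ≤ 70 := by
  have := ncard_three_eRk_le_two_le M hL hK hd (by omega)
  rw [hn] at this
  exact this

/-- `Q₄² ≤ 45` on `15` points. -/
theorem ncard_four_eRk_le_two_le_fifteen (M : Matroid α) [M.Finite] (hL : ∀ e ∈ M.E, ¬ M.IsLoop e)
    (hK : ∀ e, ¬ M.IsColoop e) (hd : M.E.encard = M.eRank + ((4 : ℕ) : ℕ∞)) (hn : M.E.ncard = 15) :
    {X : Set α | X ⊆ M.E ∧ X.ncard = 4 ∧ M.eRk X ≤ 2}.ncard ≤ 45 := by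
  have := ncard_four_eRk_le_two_le M hL hK hd (by omega)
  rw [hn] at this
  exact this

/-- `D₄ ≤ 375` on `15` points (rank form). -/
theorem ncard_four_eRk_le_three_le_fifteen (M : Matroid α) [M.Finite] (hL : ∀ e ∈ M.E, ¬ M.IsLoop e)
    (hK : ∀ e, ¬ M.IsColoop e) (hd : M.E.encard = M.eRank + ((4 : ℕ) : ℕ∞)) (hn : M.E.ncard = 15) :
    {X : Set α | X ⊆ M.E ∧ X.ncard = 4 ∧ M.eRk X ≤ 3}.ncard ≤ 375 := by
  have := ncard_four_eRk_le_three_le M hL hK hd (by omega)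
  rw [hn] at this
  have hc : (15 - 4 : ℕ).choose 2 = 55 := by decide
  rw [hc] at this
  exact this

/-- `D₃ ≤ 76` on `16` points (rank form). -/
theorem ncard_three_eRk_le_two_le_sixteen (M : Matroid α) [M.Finite] (hL : ∀ e ∈ M.E, ¬ M.IsLoop e)
    (hK : ∀ e, ¬ M.IsColoop e) (hd : M.E.encard = M.eRank + ((4 : ℕ) : ℕ∞)) (hn : M.E.ncard = 16) :
    {X : Set α | X ⊆ M.E ∧ X.ncard = 3 ∧ M.eRk X ≤ 2}.ncard ≤ 76 := by
  have := ncard_three_eRk_le_two_le M hL hK hd (by omega)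
  rw [hn] at this
  exact this

/-- `Q₄² ≤ 49` on `16` points. -/
theorem ncard_four_eRk_le_two_le_sixteen (M : Matroid α) [M.Finite] (hL : ∀ e ∈ M.E, ¬ M.IsLoop e)
    (hK : ∀ e, ¬ M.IsColoop e) (hd : M.E.encard = M.eRank + ((4 : ℕ) : ℕ∞)) (hn : M.E.ncard = 16) :
    {X : Set α | X ⊆ M.E ∧ X.ncard = 4 ∧ M.eRk X ≤ 2}.ncard ≤ 49 := by
  have := ncard_four_eRk_le_two_le M hL hK hd (by omega)
  rw [hn] at this
  exact this

/-- `D₄ ≤ 445` on `16` points (rank form). -/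
theorem ncard_four_eRk_le_three_le_sixteen (M : Matroid α) [M.Finite] (hL : ∀ e ∈ M.E, ¬ M.IsLoop e)
    (hK : ∀ e, ¬ M.IsColoop e) (hd : M.E.encard = M.eRank + ((4 : ℕ) : ℕ∞)) (hn : M.E.ncard = 16) :
    {X : Set α | X ⊆ M.E ∧ X.ncard = 4 ∧ M.eRk X ≤ 3}.ncard ≤ 445 := by
  have := ncard_four_eRk_le_three_le M hL hK hd (by omega)
  rw [hn] at this
  have hc : (16 - 4 : ℕ).choose 2 = 66 := by decide
  rw [hc] at this
  exact this

end S1CFG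

end PercRepro
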